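import Summits.BirchSwinnertonDyer.Rank1Residual.X11b.Three.BDPValueRigidityReading
import Summits.BirchSwinnertonDyer.Rank1Residual.X11b.CharacterSupply
import HarnessLib

/-!
# X11b @ `p = 3`, S27′: the S27 reading with its interpolation-character supply DISCHARGED —
# `BDPValueAt₃ W` (H2) at an X11b@3 datum follows from the frame-value statement ALONE

HONEST FRAMING (cell `b2b-bsdres`, run/shared/lean/b2b/bsd-rank1-residual/, verbatim in every
file): the goal of the cell is to DELETE the COMBINATION-SHAPED residual classes of the
Birch–Swinnerton-Dyer formula for ALL analytic-rank `≤ 1` elliptic curves over `ℚ` — "full BSD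
formula for every rank `≤ 1` curve in class `C`" assembled STRICTLY from published theorems — so
that the rank-`≤ 1` remainder becomes exactly the CONSTRUCTION-SHAPED classes, which are TYPED
(missing-input `Prop`s), NOT attempted. This is not "finishing BSD". Team N8/O2 (X11b at `3`:
`3 ‖ N`, `r_an = 1`, `E[3]` irreducible): research route; THEOREMS ONLY (no definition, no named
fact, no `sorry`); nothing booked; NO label / mark / count moved; O2 stays OPEN.

S27′ (OWNERS R8-47, seat `b2b-bsdres-x11b3-p2` gen. 5): the interpolation-character supply of the
S27 reading is now a THEOREM (multr1-p1 p269746 `X11b.characterSupplyAt`, every odd `p`, over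
x11b3 S24-a `Three.lambdaSupplyAt₃` ported to odd `p` by multr1-p2 and multr1-p2's
`LambdaSupply.exists_interpolationCharacter`); `BDPValueAt₃` at an X11b@3 datum follows from the
frame-value statement ALONE. ZERO conjectural content before and after; exactly one conjecture node
`Three.HsiehDescentAt₃` on the descent side and H2 = `Three.BDPValueAt₃` stays ONE node; no mark /
label / count moved; O2 OPEN.

## Contents (each proof ONE line: the `hsup` binder of S27 `:=` `X11b.characterSupplyAt (p := 3)`)

* `bdpValueAt₃_of_frameValue` — `Three.bdpValueAt₃_of_frameValue_of_supply` (S27, p264499,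
  `X11b/Three/BDPValueRigidityReading.lean`) with its FIRST binder `hsup` (the character supply at
  every `(K, ι', κ, γ)`: a HYPOTHESIS there) supplied by the THEOREM `X11b.characterSupplyAt` at
  `p = 3` — the binder shapes agree on the nose (`3 ↦ p` instantiated back, `p ≠ 2` by `decide`);
  no adapter. What is left is the ∃∧ input in its `∀ ι'` form ALONE (route p2's currency: for EVERY
  `ι'` inducing `𝔭`, ONE frame `(Ω_K, Ω_p, L)` with the interpolation property AND the value at `𝟙`)
  `⟹ Three.BDPValueAt₃ W` (the ∀-frame H2 of record).
* `bdpValue_and_imcDiv₃_of_frameValue` — the corollary in the currency the class-record reading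
  consumes (v4.5 `Three.forall_bsdp_of_classRecord_v45`, road (b) binder `hHb`, and
  `Three.bsdp_of_halves₃_classwide_of_hsieh2014_of_hsiehDescentAt₃`'s `hR`: the pair
  `BDPValueAt₃ W ∧ IMCDivAt₃ W`): frame value ∧ H3 ⟹ H2 ∧ H3. H3 is NOT claimed.
* `stepLAt_of_halves₃_of_frameValue` — the HALVES assembly of record `Three.stepLAt_of_halves₃`
  (S10) with H2 `:=` the frame-value input: `exists_isNewformOf ∧ CTL₀@3 ∧ H1 ∧ (frame value) ∧ H3
  ⟹ Three.StepLAt W`. A READING beside HALVES, never replacing it.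

Nothing here is asserted: every antecedent is a hypothesis; the supply clause alone became a
theorem. The statements H1/H2/H3 at `3 ‖ N` are not in print ([Castella2018] needs `p ∤ N`,
`p ≥ 5`); TYPED, not attempted.

References: [Castella2018] F. Castella, Math. Ann. 370 (2018), Thm. 3.1–3.2, §5 (arXiv:1704.06608
pp. 8–9, 12); [CastellaHsieh2018] §3.3; [Washington1997] §13.1.
-/

noncomputable section

open scoped Classical Topology

open Filter WeierstrassCurve NumberField IsDedekindDomain Field PowerSeries
  Literature.NumberTheory.EllipticCurves Literature.NumberTheory.EllipticCurves.ModularForms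
  Literature.NumberTheory.EllipticCurves.Rank1Residual
  Literature.NumberTheory.GaloisRepresentations Literature.NumberTheory.GaloisCohomology
  Summit.BirchSwinnertonDyer.Rank1Residual.X11b.AcSelmer
  Summit.BirchSwinnertonDyer.Rank1Residual.X11b.CongruenceLimit
  Summit.BirchSwinnertonDyer.Rank1Residual.X11b.Halves

namespace Summit.BirchSwinnertonDyer.Rank1Residual.X11b.Three

variable {W : WeierstrassCurve ℚ} [W.IsElliptic] [W.IsGloballyMinimal]

section FrameValue

/- The ∃∧ input in its `∀ ι'` form (route p2's currency `P2.BDPValueOnTree` at `p = 3`: for EVERY `ι'`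
inducing `𝔭`, ONE frame with interpolation ∧ value at `𝟙`), INLINE as a section hypothesis — the
SECOND binder `h12` of `Three.bdpValueAt₃_of_frameValue_of_supply` VERBATIM (no def, R8-14 (e)). -/
variable
  (h12 : ∀ (N : ℕ) [NeZero N] (K : Type) [Field K] [NumberField K] (Dt : ModularParametrizationData W N)
    (H : HeegnerDatum N (NumberField.discr K)) (ι : K →+* ℂ) (P : (W.baseChange K).toAffine.Point),
    ClassX11b W 3 → Surj W 3 → W.conductorNorm ℤ = N → IsImaginaryQuadratic K →
    Odd (NumberField.discr K) → SatisfiesHeegnerHypothesis N K →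
    (W.quadraticTwist (NumberField.discr K : ℚ)).entireLFunction 1 ≠ 0 →
    WeierstrassCurve.Affine.Point.map ι.toRatAlgHom P = heegnerPointComplex Dt H →
    ¬ (3 : ℤ) ∣ Dt.c → ¬ IsOfFinAddOrder P →
    ∀ (κ : ZpExtension K 3), κ.IsAnticyclotomic →
      ∀ (γ : Field.absoluteGaloisGroup K) [Fact (κ.IsTopGenerator γ)]
        (𝔭 : HeightOneSpectrum (𝓞 K)) (h𝔭 : ((3 : ℕ) : 𝓞 K) ∈ 𝔭.asIdeal)
        (he : 𝔭.asIdeal.ramificationIdx (𝓞 ℚ) = 1) (hf : 𝔭.asIdeal.inertiaDeg (𝓞 ℚ) = 1),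
        ∀ (f : CuspForm (CongruenceSubgroup.Gamma0 N) 2), IsNewformOf W f →
          ∀ (ι' : PadicAlgCl 3 ≃+* ℂ), InducesPrime ι' 𝔭 →
            ∃ (ΩK : ℂ) (Ωp : (unrIntegers 3)ˣ) (L : UnrSeries 3),
              ΩK ≠ 0 ∧ IsBDPLFunction ι' 𝔭 κ γ f ΩK ((Ωp : unrIntegers 3) : ℂ_[3]) L ∧
              ∃ u : (unrIntegers 3)ˣ, L.HasValueAt 0 (((u : unrIntegers 3) : ℂ_[3]) *
                (algebraMap ℚ_[3] ℂ_[3] (((1 : ℚ_[3]) - ((W.LFunction 3 : ℤ) : ℚ_[3]) * (3 : ℚ_[3])⁻¹) *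
                  logOmega W 3 (embAt K 3 𝔭 h𝔭 he hf) P)) ^ 2))

include h12 in
/-- **S27′: the interpolation-character supply of the S27 reading is now a THEOREM (multr1-p1 p269746
over x11b3 S24-a); `BDPValueAt₃` at an X11b@3 datum follows from the frame-value statement ALONE.
ZERO conjectural content before and after; exactly one conjecture node `Three.HsiehDescentAt₃` (H2);
no mark / label / count moved; O2 OPEN.** `Three.bdpValueAt₃_of_frameValue_of_supply` (S27: the value
at `𝟙` of a BDP frame is period-independent GIVEN a character supply — `constantCoeff_eq_of_isBDPLFunction
_of_supply`, any `p`) with `hsup := X11b.characterSupplyAt (p := 3)` (two sequences `φ₀^{3^k}`,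
`φ₀^{2·3^k}` of everywhere-unramified characters of types `(m 3^k, −m 3^k)`, `(2m 3^k, −2m 3^k)` with
avatars through `κ` and values `x₀^{3^k} → 1`, `x₀^{3^k} ≠ 1` at `γ`; binder shapes identical, no
adapter). Input left: for EVERY `ι'` inducing `𝔭`, ONE frame `(Ω_K, Ω_p, L)` with interpolation ∧ value
at `𝟙`; output: the ∀-frame H2 of record. A READING beside HALVES (`Three.stepLAt_of_halves₃`), never
replacing it; H2 at `3 ‖ N` is not in print; nothing asserted, nothing booked.
[cite: Castella2018, Thm. 3.1–3.2 (arXiv:1704.06608 pp. 8–9) (shape only; nothing asserted)] -/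
theorem bdpValueAt₃_of_frameValue : BDPValueAt₃ W :=
  bdpValueAt₃_of_frameValue_of_supply (characterSupplyAt (p := 3) (by decide)) h12

include h12 in
/-- **Corollary in the class-record currency**: the road-(b) binder `hHb` of the class record v4.5
(`Three.forall_bsdp_of_classRecord_v45`) and the per-pair binder `hR` of
`Three.bsdp_of_halves₃_classwide_of_hsieh2014_of_hsiehDescentAt₃` consume the PAIR
`BDPValueAt₃ W ∧ IMCDivAt₃ W`; with S27′ that pair is (frame value) ∧ H3. H3 (`IMCDivAt₃`, the
main-conjecture divisibility at `3 ‖ N`) is NOT claimed — it is passed through. Nothing booked.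
[cite: Castella2018, Thm. 3.2–3.3 (arXiv:1704.06608 p. 9) (shape only; nothing asserted)] -/
theorem bdpValue_and_imcDiv₃_of_frameValue (h3 : IMCDivAt₃ W) : BDPValueAt₃ W ∧ IMCDivAt₃ W :=
  ⟨bdpValueAt₃_of_frameValue h12, h3⟩

include h12 in
/-- **HALVES with H2 := the frame value**: `exists_isNewformOf ∧ CTL₀@3 ∧ H1 ∧ (frame value in its
`∀ ι'` form) ∧ H3 ⟹ Three.StepLAt W` — `Three.stepLAt_of_halves₃` (S10, the assembly of record) with
its H2 binder supplied by `bdpValueAt₃_of_frameValue`. Compare §1(b) `Three.stepLAt_of_frameValue₃`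
(the `∃ ι'` form, which CONSUMES H1's role): here H1 produces the frame and the `∀ ι'` frame value is
evaluated at it through H2. All antecedents hypotheses; nothing asserted; O2 OPEN.
[cite: Castella2018, §5 (arXiv:1704.06608 p. 12) (assembly shape at p ∣ N; inputs typed, not asserted)] -/
theorem stepLAt_of_halves₃_of_frameValue (hnf : exists_isNewformOf) (hctl : CharTorsionAt₃ W)
    (h1 : BDPExistsAt₃ W) (h3 : IMCDivAt₃ W) : StepLAt W :=
  stepLAt_of_halves₃ hnf hctl h1 (bdpValueAt₃_of_frameValue h12) h3

end FrameValue

end Summit.BirchSwinnertonDyer.Rank1Residual.X11b.Three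

end
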